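import Summits.Ventures.PercRepro.C026HubAttachG

/-!
# Hub attachment and the D-free inequality, VIII: the link configurations inject (p5, gen 10)

* **`flipLinks`** — every link hub of a hub part (all `c`-edges open, edges to both `a` and `b`) is
  moved to the state «all `a`-edges open, everything else closed»; on a single-direction hub part of
  signature `(0, 0, 1)` this gives a single-direction hub part of signature `(1, 0, 0)`
  (`flipLinks_sigOf`), injectively (`flipLinks_injOn`), whence **`sigCount_link_le_sigA`**
  (`N₀₀₁ ≤ N₁₀₀`); the `a ↔ b` symmetry and the theorem are in `C026HubAttachI.lean`.
-/

namespace PercRepro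

namespace MultiGraph

variable {V E : Type*} {G : MultiGraph V E}

section Flip

variable (G)

/-- A link hub of the hub part `σ`: all its `c`-edges open (at least one), edges to `a` and `b`. -/
def IsLinkHub (Hs : Set V) (a b c : V) (σ : Config E) (h : V) : Prop :=
  h ∈ Hs ∧ G.OpenTo σ h c ∧ ¬ G.ClosedTo σ h c ∧ G.HasEdge h a ∧ G.HasEdge h b

open Classical in
/-- **Move every link hub to the state «all `a`-edges open, everything else closed».** -/
noncomputable def flipLinks (Hs : Set V) (a b c : V) (σ : Config E) : Config E := fun e =>
  if ∃ h, G.IsLinkHub Hs a b c σ h ∧ G.Link e h a then true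
  else if ∃ h, G.IsLinkHub Hs a b c σ h ∧ (G.fst e = h ∨ G.snd e = h) then false
  else σ e

variable {G}

/-- Two `Link` descriptions of one edge agree up to orientation. -/
theorem Link.cases {e : E} {x y x' y' : V} (h : G.Link e x y) (h' : G.Link e x' y') :
    (x = x' ∧ y = y') ∨ (x = y' ∧ y = x') := by
  rcases h with ⟨h1, h2⟩ | ⟨h1, h2⟩ <;> rcases h' with ⟨h1', h2'⟩ | ⟨h1', h2'⟩
  · exact Or.inl ⟨h1.symm.trans h1', h2.symm.trans h2'⟩
  · exact Or.inr ⟨h1.symm.trans h1', h2.symm.trans h2'⟩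
  · exact Or.inr ⟨h2.symm.trans h2', h1.symm.trans h1'⟩
  · exact Or.inl ⟨h2.symm.trans h2', h1.symm.trans h1'⟩

/-- An edge at `x` (as an endpoint) links `x` to its other endpoint. -/
theorem link_of_endpoint {e : E} {x : V} (h : G.fst e = x ∨ G.snd e = x) :
    ∃ y, G.Link e x y := by
  rcases h with h | h
  · exact ⟨G.snd e, Or.inl ⟨h, rfl⟩⟩
  · exact ⟨G.fst e, Or.inr ⟨rfl, h⟩⟩

/-- A link has its first vertex as an endpoint. -/
theorem Link.fst_or_snd {e : E} {x y : V} (hl : G.Link e x y) : G.fst e = x ∨ G.snd e = x := by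
  rcases hl with ⟨h1, -⟩ | ⟨-, h2⟩
  · exact Or.inl h1
  · exact Or.inr h2

variable {Hs : Set V} {a b c : V}

/-- An edge at two hubs does not exist: an edge at the hub `h` with the other endpoint `y` is at the
hub `h'` only if `h' = h`. -/
theorem IsHubSet.eq_of_link_of_endpoint (hH : G.IsHubSet Hs a b c) {h : V} (hh : h ∈ Hs) {e : E}
    {y : V} (hl : G.Link e h y) {h' : V} (hh' : h' ∈ Hs) (he : G.fst e = h' ∨ G.snd e = h') :
    h' = h := by
  obtain ⟨y', hl'⟩ := link_of_endpoint he
  rcases hl.cases hl' with ⟨h1, -⟩ | ⟨-, h2⟩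
  · exact h1.symm
  · exact (hH.mark_notMem (hH.mark_of_link hh hl) (by rw [h2]; exact hh')).elim

/-- `flipLinks` opens the `a`-edges of the link hubs. -/
theorem flipLinks_apply_link_a {σ : Config E} {h : V} (hlink : G.IsLinkHub Hs a b c σ h) {e : E}
    (hl : G.Link e h a) : G.flipLinks Hs a b c σ e = true := by
  unfold flipLinks
  rw [if_pos ⟨h, hlink, hl⟩]

/-- `flipLinks` closes the other edges of the link hubs. -/
theorem flipLinks_apply_link_other (hH : G.IsHubSet Hs a b c) {σ : Config E} {h : V}
    (hlink : G.IsLinkHub Hs a b c σ h) {e : E} {y : V} (hl : G.Link e h y) (hy : y ≠ a) :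
    G.flipLinks Hs a b c σ e = false := by
  unfold flipLinks
  rw [if_neg, if_pos ⟨h, hlink, hl.fst_or_snd⟩]
  rintro ⟨h', hlink', hl'⟩
  rcases hl.cases hl' with ⟨-, h2⟩ | ⟨h1, -⟩
  · exact hy h2
  · exact hH.mark_notMem (Or.inl rfl) (by rw [← h1]; exact hlink.1)

/-- `flipLinks` leaves the edges not at a link hub alone. -/
theorem flipLinks_apply_of_not {σ : Config E} {e : E}
    (he : ∀ h, G.IsLinkHub Hs a b c σ h → ¬ (G.fst e = h ∨ G.snd e = h)) :
    G.flipLinks Hs a b c σ e = σ e := by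
  unfold flipLinks
  rw [if_neg, if_neg]
  · rintro ⟨h, hlink, hl⟩
    exact he h hlink hl
  · rintro ⟨h, hlink, hl⟩
    exact he h hlink hl.fst_or_snd

/-- An edge at a non-link hub is not at a link hub. -/
theorem IsHubSet.not_at_link (hH : G.IsHubSet Hs a b c) {σ : Config E} {h' : V} (hh' : h' ∈ Hs)
    (hnot : ¬ G.IsLinkHub Hs a b c σ h') {e : E} {y : V} (hl : G.Link e h' y) :
    ∀ h, G.IsLinkHub Hs a b c σ h → ¬ (G.fst e = h ∨ G.snd e = h) := by
  intro h hlink he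
  exact hnot ((hH.eq_of_link_of_endpoint hh' hl hlink.1 he) ▸ hlink)

/-- `OpenTo` at a non-link hub is unchanged. -/
theorem IsHubSet.openTo_flipLinks_iff (hH : G.IsHubSet Hs a b c) {σ : Config E} {h' : V}
    (hh' : h' ∈ Hs) (hnot : ¬ G.IsLinkHub Hs a b c σ h') (y : V) :
    G.OpenTo (G.flipLinks Hs a b c σ) h' y ↔ G.OpenTo σ h' y := by
  constructor
  · rintro ⟨e, he, hl⟩
    rw [flipLinks_apply_of_not (hH.not_at_link hh' hnot hl)] at he
    exact ⟨e, he, hl⟩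
  · rintro ⟨e, he, hl⟩
    refine ⟨e, ?_, hl⟩
    rw [flipLinks_apply_of_not (hH.not_at_link hh' hnot hl)]
    exact he

/-- `ClosedTo` at a non-link hub is unchanged. -/
theorem IsHubSet.closedTo_flipLinks_iff (hH : G.IsHubSet Hs a b c) {σ : Config E} {h' : V}
    (hh' : h' ∈ Hs) (hnot : ¬ G.IsLinkHub Hs a b c σ h') (y : V) :
    G.ClosedTo (G.flipLinks Hs a b c σ) h' y ↔ G.ClosedTo σ h' y := by
  constructor
  · rintro ⟨e, he, hl⟩
    rw [flipLinks_apply_of_not (hH.not_at_link hh' hnot hl)] at he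
    exact ⟨e, he, hl⟩
  · rintro ⟨e, he, hl⟩
    refine ⟨e, ?_, hl⟩
    rw [flipLinks_apply_of_not (hH.not_at_link hh' hnot hl)]
    exact he

/-- A link hub is open to `a` after the flip. -/
theorem flipLinks_openTo_a {σ : Config E} {h : V} (hlink : G.IsLinkHub Hs a b c σ h) :
    G.OpenTo (G.flipLinks Hs a b c σ) h a := by
  obtain ⟨e, hl⟩ := hlink.2.2.2.1
  exact ⟨e, flipLinks_apply_link_a hlink hl, hl⟩

/-- A link hub is closed to every `y ≠ a` after the flip. -/
theorem flipLinks_not_openTo (hH : G.IsHubSet Hs a b c) {σ : Config E} {h : V}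
    (hlink : G.IsLinkHub Hs a b c σ h) {y : V} (hy : y ≠ a) :
    ¬ G.OpenTo (G.flipLinks Hs a b c σ) h y := by
  rintro ⟨e, he, hl⟩
  rw [flipLinks_apply_link_other hH hlink hl hy] at he
  exact Bool.noConfusion he

/-- A link hub has a closed `c`-edge after the flip. -/
theorem flipLinks_closedTo_c (hH : G.IsHubSet Hs a b c) (hac : a ≠ c) {σ : Config E} {h : V}
    (hlink : G.IsLinkHub Hs a b c σ h) : G.ClosedTo (G.flipLinks Hs a b c σ) h c := by
  obtain ⟨e, -, hl⟩ := hlink.2.1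
  exact ⟨e, flipLinks_apply_link_other hH hlink hl hac.symm, hl⟩

/-- `flipLinks` preserves `HubOnly`. -/
theorem hubOnly_flipLinks {σ : Config E} (hσ : G.HubOnly Hs σ) :
    G.HubOnly Hs (G.flipLinks Hs a b c σ) := by
  intro e he
  rw [flipLinks_apply_of_not, hσ e he]
  intro h hlink hl
  rcases hl with h1 | h1
  · exact he (Or.inl (by rw [h1]; exact hlink.1))
  · exact he (Or.inr (by rw [h1]; exact hlink.1))

/-- `flipLinks` preserves `SingleDir`. -/
theorem singleDir_flipLinks (hH : G.IsHubSet Hs a b c) (hab : a ≠ b) (hac : a ≠ c) {σ : Config E}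
    (hsd : G.SingleDir Hs a b c σ) : G.SingleDir Hs a b c (G.flipLinks Hs a b c σ) := by
  intro h hh
  by_cases hlink : G.IsLinkHub Hs a b c σ h
  · have hnb := flipLinks_not_openTo hH hlink hab.symm
    have hnc := flipLinks_not_openTo hH hlink hac.symm
    exact ⟨fun h => hnb h.2, fun h => hnc h.2, fun h => hnb h.1⟩
  · simp only [hH.openTo_flipLinks_iff hh hlink]
    exact hsd h hh

/-- **The signature after the flip**: from `(0, 0, 1)` to `(1, 0, 0)`. -/
theorem flipLinks_sigOf (hH : G.IsHubSet Hs a b c) (hab : a ≠ b) (hac : a ≠ c) {σ : Config E}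
    (hs : G.sigOf Hs a b c σ = (false, false, true)) :
    G.sigOf Hs a b c (G.flipLinks Hs a b c σ) = (true, false, false) := by
  classical
  simp only [sigOf, Prod.mk.injEq, decide_eq_false_iff_not, decide_eq_true_eq] at hs ⊢
  obtain ⟨-, hnB, hlinkσ⟩ := hs
  obtain ⟨h₀, hh₀, -, h₀c, h₀cl, h₀a, h₀b⟩ := hlinkσ
  have hlink₀ : G.IsLinkHub Hs a b c σ h₀ := ⟨hh₀, h₀c, h₀cl, h₀a, h₀b⟩
  refine ⟨⟨h₀, hh₀, fun h => h, Or.inl ⟨flipLinks_openTo_a hlink₀,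
    flipLinks_closedTo_c hH hac hlink₀⟩⟩, ?_, ?_⟩
  · rintro ⟨h, hh, -, hcase⟩
    by_cases hlink : G.IsLinkHub Hs a b c σ h
    · rcases hcase with ⟨hob, -⟩ | ⟨hoc, -⟩
      · exact flipLinks_not_openTo hH hlink hab.symm hob
      · exact flipLinks_not_openTo hH hlink hac.symm hoc
    · simp only [hH.openTo_flipLinks_iff hh hlink, hH.closedTo_flipLinks_iff hh hlink] at hcase
      exact hnB ⟨h, hh, fun h => h, hcase⟩
  · rintro ⟨h, hh, -, hoc, hcl, hea, heb⟩
    by_cases hlink : G.IsLinkHub Hs a b c σ h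
    · exact flipLinks_not_openTo hH hlink hac.symm hoc
    · rw [hH.openTo_flipLinks_iff hh hlink, hH.closedTo_flipLinks_iff hh hlink] at *
      exact hlink ⟨hh, hoc, hcl, hea, heb⟩

/-- **A link hub is recognised after the flip**: on a single-direction hub part without `SigA`, the
link hubs are exactly the hubs open to `a` with a `c`-edge. -/
theorem isLinkHub_iff_flip (hH : G.IsHubSet Hs a b c) {σ : Config E}
    (hsd : G.SingleDir Hs a b c σ) (hnA : ¬ G.SigM Hs ∅ σ a c) (h : V) :
    G.IsLinkHub Hs a b c σ h ↔
      h ∈ Hs ∧ G.OpenTo (G.flipLinks Hs a b c σ) h a ∧ G.HasEdge h c := by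
  constructor
  · intro hlink
    obtain ⟨e, -, hl⟩ := hlink.2.1
    exact ⟨hlink.1, flipLinks_openTo_a hlink, e, hl⟩
  · rintro ⟨hh, hoa, e, hl⟩
    by_contra hlink
    rw [hH.openTo_flipLinks_iff hh hlink] at hoa
    have hnoc : ¬ G.OpenTo σ h c := fun hoc => (hsd h hh).2.1 ⟨hoa, hoc⟩
    have hncl : ¬ G.ClosedTo σ h c := fun hcl => hnA ⟨h, hh, fun h => h, Or.inl ⟨hoa, hcl⟩⟩
    cases he : σ e
    · exact hncl ⟨e, he, hl⟩
    · exact hnoc ⟨e, he, hl⟩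

/-- **`flipLinks` is injective on the link configurations.** -/
theorem flipLinks_injOn (hH : G.IsHubSet Hs a b c) (hac : a ≠ c) (hbc : b ≠ c) {σ₁ σ₂ : Config E}
    (hsd₁ : G.SingleDir Hs a b c σ₁) (hsd₂ : G.SingleDir Hs a b c σ₂)
    (hnA₁ : ¬ G.SigM Hs ∅ σ₁ a c) (hnA₂ : ¬ G.SigM Hs ∅ σ₂ a c)
    (heq : G.flipLinks Hs a b c σ₁ = G.flipLinks Hs a b c σ₂) : σ₁ = σ₂ := by
  classical
  have hlink : ∀ h, G.IsLinkHub Hs a b c σ₁ h ↔ G.IsLinkHub Hs a b c σ₂ h := by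
    intro h
    rw [isLinkHub_iff_flip hH hsd₁ hnA₁, isLinkHub_iff_flip hH hsd₂ hnA₂, heq]
  funext e
  by_cases he : ∃ h, G.IsLinkHub Hs a b c σ₁ h ∧ (G.fst e = h ∨ G.snd e = h)
  · -- an edge at a common link hub: its state is forced in both
    obtain ⟨h, hlink₁, hend⟩ := he
    have hlink₂ : G.IsLinkHub Hs a b c σ₂ h := (hlink h).1 hlink₁
    obtain ⟨y, hl⟩ := link_of_endpoint hend
    have hy := hH.mark_of_link hlink₁.1 hl
    have forced : ∀ σ, G.IsLinkHub Hs a b c σ h → G.SingleDir Hs a b c σ →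
        σ e = if y = c then true else false := by
      intro σ hlink hsd
      rcases hy with rfl | rfl | rfl
      · rw [if_neg hac]
        cases hσe : σ e
        · rfl
        · exact ((hsd h hlink.1).2.1 ⟨⟨e, hσe, hl⟩, hlink.2.1⟩).elim
      · rw [if_neg hbc]
        cases hσe : σ e
        · rfl
        · exact ((hsd h hlink.1).2.2 ⟨⟨e, hσe, hl⟩, hlink.2.1⟩).elim
      · rw [if_pos rfl]
        cases hσe : σ e
        · exact (hlink.2.2.1 ⟨e, hσe, hl⟩).elim
        · rfl
    rw [forced σ₁ hlink₁ hsd₁, forced σ₂ hlink₂ hsd₂]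
  · -- an edge at no link hub: the flip is the identity on both
    have he₂ : ¬ ∃ h, G.IsLinkHub Hs a b c σ₂ h ∧ (G.fst e = h ∨ G.snd e = h) := by
      rintro ⟨h, hlink₂, hend⟩
      exact he ⟨h, (hlink h).2 hlink₂, hend⟩
    have h1 : G.flipLinks Hs a b c σ₁ e = σ₁ e :=
      flipLinks_apply_of_not (fun h hl hend => he ⟨h, hl, hend⟩)
    have h2 : G.flipLinks Hs a b c σ₂ e = σ₂ e :=
      flipLinks_apply_of_not (fun h hl hend => he₂ ⟨h, hl, hend⟩)
    rw [← h1, ← h2, heq]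

variable [Fintype E] [DecidableEq E]

open Classical in
/-- **`N₀₀₁ ≤ N₁₀₀`**: the link configurations inject into the `SigA` configurations. -/
theorem sigCount_link_le_sigA (hH : G.IsHubSet Hs a b c) (hab : a ≠ b) (hac : a ≠ c) (hbc : b ≠ c) :
    G.sigCount Hs a b c (false, false, true) ≤ G.sigCount Hs a b c (true, false, false) := by
  unfold sigCount
  refine Finset.card_le_card_of_injOn (G.flipLinks Hs a b c) ?_ ?_
  · intro σ hσ
    simp only [Finset.coe_filter, Finset.mem_univ, true_and, Set.mem_setOf_eq] at hσ ⊢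
    obtain ⟨h1, h2, h3⟩ := hσ
    exact ⟨hubOnly_flipLinks h1, singleDir_flipLinks hH hab hac h2, flipLinks_sigOf hH hab hac h3⟩
  · intro σ₁ hσ₁ σ₂ hσ₂ heq
    simp only [Finset.coe_filter, Finset.mem_univ, true_and, Set.mem_setOf_eq] at hσ₁ hσ₂
    have hnA : ∀ σ, G.sigOf Hs a b c σ = (false, false, true) → ¬ G.SigM Hs ∅ σ a c := by
      intro σ hs
      simp only [sigOf, Prod.mk.injEq, decide_eq_false_iff_not, decide_eq_true_eq] at hs
      exact hs.1
    exact flipLinks_injOn hH hac hbc hσ₁.2.1 hσ₂.2.1 (hnA σ₁ hσ₁.2.2) (hnA σ₂ hσ₂.2.2) heq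

end Flip

end MultiGraph

end PercRepro
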